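import Summits.BirchSwinnertonDyer.BirchSwinnertonDyer.Theorems.KatoDescentPotSupersingularTowerTorsionOrdinaryBricks
import Summits.BirchSwinnertonDyer.BirchSwinnertonDyer.Theorems.KatoDescentPotSupersingularTowerTorsionFinite
import Summits.BirchSwinnertonDyer.Rank1Residual.X11b.KolyvaginFrobeniusEigenparts
import Literature.NumberTheory.EllipticCurves.CyclotomicTowerLocalInertiaFiniteIndexProofs
import HarnessLib

/-!
# The LOCAL ORDINARY LEMMA behind Imai's finiteness, and the line-free Fin_v reduction KEEPING «fixed by the tower group»
# (route-free helper for crux M = stmt-BirchSwinnertonDyer-19196 `ReducibleKatoMember`, K9 / K8-t′; seat `bsd-potss-rkm` g32;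
# FILE 2 of 3)

* §4 `exists_fixing_rootsOfUnity_forall_eq_bot_of_hasUnitRootAt` — **the local ordinary lemma.**  `E/F` an elliptic curve over a number
  field, `p` a prime, `w ∣ p` a place of GOOD ORDINARY reduction (`HasGoodReductionAt`, `HasUnitRootAt`).  There is `γ ∈ Γ_{F_w}` FIXING
  EVERY `p`-POWER ROOT OF UNITY of `F̄_w` (and, through `Γ_{F_w} → Γ_F`, of `F̄`) — namely `γ = ι·σ_w^e`, `σ_w` an arithmetic Frobenius,
  `ι` an inertia element, `e = e(w ∣ p)`, from the ramified cyclotomic lemma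
  `IsDedekindDomain.HeightOneSpectrum.exists_forall_exists_mem_inertia_mul_pow_smul_rootOfUnity_eq` (this seat, p683052) — such that
  every `p`-primary `p`-DIVISIBLE subgroup `N ≤ E(F̄)` fixed pointwise by `γ` is ZERO.  Proof, with the reduction map
  `f : E(F̄) → Ẽ_w(k̄_w)` of `exists_goodReductionHom_frobenius` (inertia-invariant, `f(σ_w a) = φ_w f(a)`, `#(ker f ∩ E[p]) = p` —
  Serre's line): `f(γ a) = φ_w^e f(a)`, so `f(N) ⊆ Fix(φ_w^e)` is finite (FILE 1 §1) and `N ≤ ker f` (FILE 1 §2); were `N ≠ 0` it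
  would contain points `P` of every order `p^n`, the Weil-pairing annihilator lemma (FILE 1 §3) would give `γR - R ∈ ℤ·P ⊆ ker f`
  for all `R ∈ E[p^n]`, i.e. `φ_w^e` fixes `f(E[p^n])`, a set with at least `#E[p^n]/#(ker f ∩ E[p^n]) ≥ p^{2n}/p^n = p^n`
  elements (`#(ker f ∩ E[p^n]) ≤ p^n` from `#(ker f ∩ E[p]) = p`) — unbounded inside the finite `Fix(φ_w^e)`.  NO unit-root
  eigenvalue, NO weight argument: only `Ẽ_w(𝔽_{q^e})` finite and `e_{p^n}` Galois-equivariant.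
* §5 `WeierstrassCurve.localTowerTorsionFiniteAt_of_noFixedStableDivisibleLine` — kmc g16's line-free reduction
  (`…_of_noStableDivisibleLine`, proof adapted verbatim, one clause threaded through): Fin_v holds as soon as (i′) every `D_𝔭`-stable
  `p`-divisible `N ≤ E(K̄)[p^∞]` with `#N[p] ≤ p` that is FIXED POINTWISE by `D_𝔭 ⊓ ker κ` is zero and (ii) the tower group moves
  some `p`-torsion point.  (At a potentially ORDINARY prime stable divisible lines EXIST — the kernel of reduction — so kmc's (i)
  fails; (i′) is what §4 supplies after transport, FILE 3.)

Theorems only (no definition, no named fact, no `sorry`); route-free; closes nothing by itself; BSD is proved for no curve.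

References: [Imai1975] Theorem (p. 12); [SerreInventiones1972] §1.11 Prop. 11; [SilvermanAEC2009] Prop. III.8.1, VII.§2;
[GreenbergLNM1716] §1 p. 62, §2 p. 70, §3 Lemma 3.3 (p. 87); [JetchevSkinnerWan2017] Prop. 3.3.4 Case 3(b); [NeukirchANT1999]
Ch. II (7.13), §9; tree: `OrdinaryReductionFrobeniusHomProofs.lean`, `CyclotomicTowerLocalInertiaFiniteIndexProofs.lean`,
`LocalTowerTorsionFiniteOfNoStableDivisibleLine.lean` (kmc g16), `X11b/KolyvaginFrobeniusEigenparts.lean` (`#G[p^j] ≤ p^j`).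
-/

-- the summit and its single problem are both named `BirchSwinnertonDyer` (registry layout D-0017)
set_option linter.dupNamespace false
set_option autoImplicit false

noncomputable section

open scoped Classical NumberField AddSubgroup
open Function Field NumberField IsDedekindDomain WeierstrassCurve
open Literature.NumberTheory.EllipticCurves Literature.NumberTheory.EllipticCurves.GreenbergSelmer
open Literature.NumberTheory.GaloisRepresentations
open Summit.BirchSwinnertonDyer.BirchSwinnertonDyer.Theorems.SchneiderFreeAdditiveX3
open Summit.BirchSwinnertonDyer.BirchSwinnertonDyer.Theorems.SchneiderFreeControlAtoms

universe u

namespace Summit.BirchSwinnertonDyer.BirchSwinnertonDyer.Theorems.TowerTorsionFiniteOrdinary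

/-! ## §4 The local ordinary lemma: a `p`-divisible subgroup of `E(F̄)` fixed by `ι·Frob_w^e` is zero -/

/-- Points of every order `p^k` in a non-zero `p`-primary `p`-divisible subgroup of `E(F̄)`. [folklore] -/
theorem exists_mem_addOrderOf_eq_pow {F : Type} [Field F] [NumberField F] (E : WeierstrassCurve F) [E.IsElliptic]
    (p : ℕ) [hp : Fact p.Prime] (N : AddSubgroup (geomPoints E)) (hprim : ∀ c ∈ N, ∃ k : ℕ, p ^ k • c = 0)
    (hdiv : ∀ c ∈ N, ∃ c' ∈ N, p • c' = c) (hbot : N ≠ ⊥) (k : ℕ) :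
    ∃ c ∈ N, addOrderOf c = p ^ k := by
  set M : AddSubgroup (geomPoints E) := E.geomPrimaryTorsion p with hM
  set C : AddSubgroup M := N.comap M.subtype with hC
  have htorM : ∀ x : M, ∃ k : ℕ, p ^ k • x = 0 := fun x ↦ by
    obtain ⟨k, hk⟩ := x.2
    exact ⟨k, Subtype.ext (by rw [AddSubgroupClass.coe_nsmul, hk]; rfl)⟩
  have hmemM : ∀ c ∈ N, c ∈ M := fun c hc ↦ by
    obtain ⟨k, hk⟩ := hprim c hc
    exact ⟨k, hk⟩
  have hCdiv : ∀ c ∈ C, ∃ c' ∈ C, p • c' = c := by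
    intro c hc
    rw [hC, AddSubgroup.mem_comap] at hc
    obtain ⟨c', hc', hpc'⟩ := hdiv _ hc
    refine ⟨⟨c', hmemM c' hc'⟩, ?_, Subtype.ext ?_⟩
    · rw [hC, AddSubgroup.mem_comap]; exact hc'
    · rw [AddSubgroupClass.coe_nsmul]; exact hpc'
  have hCbot : C ≠ ⊥ := by
    intro hCb
    apply hbot
    rw [eq_bot_iff]
    intro c hc
    have h : (⟨c, hmemM c hc⟩ : M) ∈ C := by rw [hC, AddSubgroup.mem_comap]; exact hc
    rw [hCb, AddSubgroup.mem_bot] at h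
    rw [AddSubgroup.mem_bot]
    exact congrArg Subtype.val h
  obtain ⟨c, hcC, hcord⟩ :=
    SchneiderFreeAdditiveX3.exists_addOrderOf_eq_pow_of_divisible_of_ne_bot C htorM hCdiv hCbot k
  refine ⟨(c : geomPoints E), (AddSubgroup.mem_comap.mp hcC), ?_⟩
  rw [← hcord]
  exact addOrderOf_injective M.subtype Subtype.coe_injective c

/-- **The local ordinary lemma.**  Let `E/F` be an elliptic curve over a number field, `p` a prime and `w ∣ p` a place of
GOOD ORDINARY reduction (`HasGoodReductionAt`, `HasUnitRootAt`).  There is `γ ∈ Γ_{F_w}` FIXING EVERY `p`-POWER ROOT OF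
UNITY of `F̄_w` — `γ = ι·σ_w^e` with `σ_w` an arithmetic Frobenius, `ι` an inertia element and `e = e(w ∣ p)`
(`exists_forall_exists_mem_inertia_mul_pow_smul_rootOfUnity_eq`) — such that every `p`-primary, `p`-DIVISIBLE subgroup
`N ≤ E(F̄)` fixed pointwise by `γ` (through `Γ_{F_w} → Γ_F`) is ZERO.  Proof, with the reduction map `f : E(F̄) → Ẽ_w(k̄_w)`
of `exists_goodReductionHom_frobenius` (inertia-invariant, `f(σ_w a) = φ_w f(a)`, `#(ker f ∩ E[p]) = p`): `f(N)` is fixed by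
`φ_w^e`, hence finite (`Ẽ_w(𝔽_{q^e})`), so `N ≤ ker f` (divisible with finite image); if `N ≠ 0` it has a point `P` of order
`p^n` for every `n`, and the Weil pairing gives `γR - R ∈ ℤ·P ⊆ ker f` for all `R ∈ E[p^n]`, i.e. `φ_w^e` fixes `f(E[p^n])`,
a set of size `≥ p^{2n}/p^n = p^n` — unbounded in the finite `Ẽ_w(𝔽_{q^e})`.  NO unit-root eigenvalue, NO weight argument.
[cite: Imai1975, Theorem (p. 12)] [cite: SerreInventiones1972, §1.11 Prop. 11] [cite: SilvermanAEC2009, Prop. III.8.1, VII.§2]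
[cite: GreenbergLNM1716, §1 p. 62 and §2 p. 70] -/
theorem exists_fixing_rootsOfUnity_forall_eq_bot_of_hasUnitRootAt {F : Type} [Field F] [NumberField F]
    (E : WeierstrassCurve F) [E.IsElliptic] (p : ℕ) [hp : Fact p.Prime] (w : HeightOneSpectrum (𝓞 F))
    (hpw : (p : 𝓞 F) ∈ w.asIdeal) (hgood : E.HasGoodReductionAt w) (hunit : E.HasUnitRootAt w) :
    ∃ γ : absoluteGaloisGroup (w.adicCompletion F),
      (∀ (k : ℕ) (ξ : AlgebraicClosure (w.adicCompletion F)), ξ ^ p ^ k = 1 → γ • ξ = ξ) ∧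
      (∀ (k : ℕ) (ξ : AlgebraicClosure F), ξ ^ p ^ k = 1 → absGaloisRestrict F (w.adicCompletion F) γ • ξ = ξ) ∧
      ∀ N : AddSubgroup (geomPoints E), (∀ c ∈ N, ∃ k : ℕ, p ^ k • c = 0) →
        (∀ c ∈ N, ∃ c' ∈ N, p • c' = c) →
        (∀ c ∈ N, absGaloisRestrict F (w.adicCompletion F) γ • c = c) → N = ⊥ := by
  have hpp : p.Prime := hp.out
  have hpF : (p : F) ≠ 0 := Nat.cast_ne_zero.mpr hpp.ne_zero
  -- Frobenius data at `w` and the reduction map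
  obtain ⟨𝔐, h𝔐⟩ := w.localPrimesAbove_nonempty
  obtain ⟨σF, hσF⟩ := w.exists_isArithFrobAt_localAbsIntegers h𝔐
  haveI : Finite (IsLocalRing.ResidueField (w.adicCompletionIntegers F)) :=
    IsDedekindDomain.HeightOneSpectrum.finite_residueField_adicCompletionIntegers F w
  obtain ⟨φ, hφ⟩ := exists_frobenius_absoluteGaloisGroup (IsLocalRing.ResidueField (w.adicCompletionIntegers F))
  have hord : ¬ ((p : ℤ) ∣ E.frobeniusTraceAt w) := by
    have h : ¬ ((ringChar (IsLocalRing.ResidueField (w.adicCompletionIntegers F)) : ℤ) ∣ E.frobeniusTraceAt w) := hunit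
    rwa [WeierstrassCurve.ringChar_residueField_eq w hpp hpw] at h
  obtain ⟨f, -, hI, hF, hK⟩ := exists_goodReductionHom_frobenius E p w hpw hgood hord h𝔐 hσF hφ
  -- the element `γ = ι σ_w^e` fixing `μ_{p^∞}` (the ramified cyclotomic lemma)
  obtain ⟨wv, hwv⟩ := w.exists_spectralValuation
  obtain ⟨e, he1, hγ⟩ :=
    IsDedekindDomain.HeightOneSpectrum.exists_forall_exists_mem_inertia_mul_pow_smul_rootOfUnity_eq hwv h𝔐 hpw
  obtain ⟨ι, hι, hfix⟩ := hγ σF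
  set res := absGaloisRestrict F (w.adicCompletion F) with hres
  -- `res γ` fixes the `p`-power roots of unity of `F̄`
  have hresfix : ∀ (k : ℕ) (ξ : AlgebraicClosure F), ξ ^ p ^ k = 1 → res (ι * σF ^ e) • ξ = ξ := by
    intro k ξ hξ
    apply (closureEmb (K := F) (w.adicCompletion F)).toRingHom.injective
    have h1 : closureEmb (K := F) (w.adicCompletion F) (res (ι * σF ^ e) • ξ) =
        (ι * σF ^ e) • closureEmb (K := F) (w.adicCompletion F) ξ := by
      rw [hres, ← WeierstrassCurve.resGal_eq_absGaloisRestrict, resGal_eq]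
      exact apply_resGalAuxOfEmb_apply _ _ ξ
    change closureEmb (K := F) (w.adicCompletion F) (res (ι * σF ^ e) • ξ) = closureEmb (K := F) (w.adicCompletion F) ξ
    rw [h1]
    exact hfix k _ (by rw [← map_pow, hξ, map_one])
  refine ⟨ι * σF ^ e, hfix, hresfix, ?_⟩
  intro N hprim hdiv hNfix
  -- `f (res γ • a) = φ^e • f a`
  have hιabs : ι ∈ absInertia (w.adicCompletion F) := by
    rw [← IsDedekindDomain.HeightOneSpectrum.inertia_eq_absInertia hwv h𝔐]; exact hι
  have hFpow : ∀ (n : ℕ) (a : geomPoints E), f (res (σF ^ n) • a) = φ ^ n • f a := by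
    intro n
    induction n with
    | zero => intro a; rw [pow_zero, map_one, one_smul, pow_zero, one_smul]
    | succ n ih => intro a; rw [pow_succ, map_mul, mul_smul, ih, hF, ← mul_smul, ← pow_succ]
  have hγf : ∀ a : geomPoints E, f (res (ι * σF ^ e) • a) = φ ^ e • f a := by
    intro a
    rw [map_mul, mul_smul, hI ι hιabs, hFpow]
  -- the image of `N` is fixed by `φ^e`, hence finite; so `N ≤ ker f`
  have hfinS := finite_setOf_frobenius_pow_smul_eq (E.reductionAt w) hφ he1
  have hNker : N ≤ f.ker := by
    refine le_ker_of_divisible_of_finite_map f p N hprim hdiv (hfinS.subset ?_)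
    rintro _ ⟨c, hc, rfl⟩
    change φ ^ e • f c = f c
    rw [← hγf, hNfix c hc]
  -- finiteness of `ker f ∩ E[m]`
  have hfinI : ∀ m : ℕ, m ≠ 0 → Finite ↥(f.ker ⊓ geomTorsion E (m : ℤ)) := by
    intro m hm
    haveI : Finite (geomTorsion E (m : ℤ)) := E.finite_torsionPoints_holds (AlgebraicClosure F) (by exact_mod_cast hm)
    refine Finite.of_injective (fun x : ↥(f.ker ⊓ geomTorsion E (m : ℤ)) ↦
      (⟨(x : geomPoints E), (AddSubgroup.mem_inf.mp x.2).2⟩ : geomTorsion E (m : ℤ))) ?_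
    intro x y hxy
    have h := congrArg Subtype.val hxy
    exact Subtype.ext h
  -- suppose `N ≠ ⊥`
  by_contra hNbot
  -- the size of `ker f ∩ E[p^n]` is at most `p^n`
  have hkerle : ∀ n : ℕ, Nat.card ↥(f.ker ⊓ geomTorsion E ((p ^ n : ℕ) : ℤ)) ≤ p ^ n := by
    intro n
    haveI : Finite ↥(f.ker ⊓ geomTorsion E ((p : ℕ) : ℤ)) := hfinI p hpp.ne_zero
    set G : AddSubgroup (geomPoints E) := f.ker ⊓ geomTorsion E ((p ^ n : ℕ) : ℤ) with hG
    haveI : Finite G := hfinI (p ^ n) (pow_ne_zero n hpp.ne_zero)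
    -- `#G[p] ≤ p`
    have h1 : Nat.card (AddSubgroup.torsionBy G (p : ℤ)) ≤ p := by
      refine le_trans (Nat.card_le_card_of_injective (fun x ↦ (⟨((x : G) : geomPoints E), AddSubgroup.mem_inf.mpr
        ⟨(AddSubgroup.mem_inf.mp (x : G).2).1, ?_⟩⟩ : ↥(f.ker ⊓ geomTorsion E ((p : ℕ) : ℤ)))) ?_) hK.le
      · have hx : (p : ℤ) • (x : G) = 0 := mem_torsionBy_iff.mp x.2
        rw [mem_geomTorsion_iff]
        have h := congrArg (fun y : G ↦ (y : geomPoints E)) hx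
        simpa only [AddSubgroupClass.coe_zsmul, ZeroMemClass.coe_zero] using h
      · intro x y hxy
        have h := congrArg Subtype.val hxy
        exact Subtype.ext (Subtype.ext h)
    -- `G = G[p^n]`
    have h2 : Nat.card G = Nat.card (AddSubgroup.torsionBy G ((p : ℤ) ^ n)) := by
      have htop : AddSubgroup.torsionBy G ((p : ℤ) ^ n) = ⊤ := by
        rw [eq_top_iff]
        intro x _
        rw [AddSubgroup.torsionBy, Submodule.mem_toAddSubgroup, Submodule.mem_torsionBy_iff]
        apply Subtype.ext
        have hx : ((p ^ n : ℕ) : ℤ) • ((x : G) : geomPoints E) = 0 :=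
          (mem_geomTorsion_iff E _ _).mp (AddSubgroup.mem_inf.mp x.2).2
        rw [AddSubgroupClass.coe_zsmul, ZeroMemClass.coe_zero, ← hx, Nat.cast_pow]
      rw [htop, AddSubgroup.card_top]
    rw [h2]
    exact Summit.BirchSwinnertonDyer.Rank1Residual.X11b.KolyvaginH44.natCard_torsionBy_pow_le h1 n
  -- `φ^e` fixes `f(E[p^n])` for every `n`
  have hfixE : ∀ (n : ℕ) (R : geomPoints E), R ∈ geomTorsion E ((p ^ n : ℕ) : ℤ) → φ ^ e • f R = f R := by
    intro n R hR
    obtain ⟨P, hPN, hPord⟩ := exists_mem_addOrderOf_eq_pow E p N hprim hdiv hNbot n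
    have hmem := smul_sub_mem_zmultiples_of_fixing_rootsOfUnity E hpp hpF hresfix hPord (hNfix P hPN) hR
    have hker : res (ι * σF ^ e) • R - R ∈ f.ker :=
      (AddSubgroup.zmultiples_le_of_mem (hNker hPN)) hmem
    rw [AddMonoidHom.mem_ker, map_sub, sub_eq_zero, hγf] at hker
    exact hker
  -- counting: `p^n ≤ #f(E[p^n]) ≤ #Fix(φ^e)` for all `n`
  set S := hfinS.toFinset with hSdef
  obtain ⟨n, hn⟩ : ∃ n : ℕ, S.card < p ^ n := ⟨S.card, Nat.lt_pow_self hpp.one_lt⟩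
  haveI hfinT : Finite (geomTorsion E ((p ^ n : ℕ) : ℤ)) :=
    E.finite_torsionPoints_holds (AlgebraicClosure F) (by exact_mod_cast pow_ne_zero n hpp.ne_zero)
  haveI : Finite ↥(f.ker ⊓ geomTorsion E ((p ^ n : ℕ) : ℤ)) := hfinI (p ^ n) (pow_ne_zero n hpp.ne_zero)
  -- restrict `f` to `E[p^n]`
  set fn : geomTorsion E ((p ^ n : ℕ) : ℤ) →+ geomPoints (E.reductionAt w) := f.comp (geomTorsion E ((p ^ n : ℕ) : ℤ)).subtype
    with hfn
  have hcardT : Nat.card (geomTorsion E ((p ^ n : ℕ) : ℤ)) = p ^ (2 * n) :=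
    card_geomTorsion_pow_eq E p (card_torsionPoints_eq_sq_holds E (AlgebraicClosure F)) hpF n
  have hkerfn : Nat.card fn.ker ≤ p ^ n := by
    refine le_trans (Nat.card_le_card_of_injective (fun x : fn.ker ↦ (⟨((x : geomTorsion E ((p ^ n : ℕ) : ℤ)) : geomPoints E),
      AddSubgroup.mem_inf.mpr ⟨?_, (x : geomTorsion E ((p ^ n : ℕ) : ℤ)).2⟩⟩ : ↥(f.ker ⊓ geomTorsion E ((p ^ n : ℕ) : ℤ)))) ?_)
      (hkerle n)
    · have hx := x.2
      rw [AddMonoidHom.mem_ker] at hx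
      exact hx
    · intro x y hxy
      have h := congrArg Subtype.val hxy
      exact Subtype.ext (Subtype.ext h)
  have hrange : p ^ n ≤ Nat.card fn.range := by
    have h1 : Nat.card fn.ker * Nat.card fn.range = p ^ (2 * n) := by
      rw [← AddSubgroup.index_ker, AddSubgroup.card_mul_index, hcardT]
    by_contra hlt
    push Not at hlt
    have h2 : Nat.card fn.ker * Nat.card fn.range < p ^ n * p ^ n :=
      Nat.mul_lt_mul_of_le_of_lt hkerfn hlt (pow_pos hpp.pos n)
    rw [h1, ← pow_add, show n + n = 2 * n by ring] at h2
    exact lt_irrefl _ h2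
  -- `range fn ⊆ S`
  have hsub : (fn.range : Set (geomPoints (E.reductionAt w))) ⊆ (S : Set (geomPoints (E.reductionAt w))) := by
    rintro _ ⟨x, rfl⟩
    rw [hSdef, Set.Finite.coe_toFinset]
    exact hfixE n x x.2
  have hle : Nat.card fn.range ≤ S.card := by
    have h1 : Nat.card ↥((fn.range : Set (geomPoints (E.reductionAt w)))) ≤
        Nat.card ↥((S : Set (geomPoints (E.reductionAt w)))) := Nat.card_mono S.finite_toSet hsub
    rw [Finset.coe_sort_coe, Nat.card_eq_finsetCard] at h1
    exact h1
  omega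

/-! ## §5 Fin_v without a FIXED line (the kmc line-free reduction, keeping «fixed by the tower group») -/

/-- **Fin_v from the absence of a `D_𝔭`-stable divisible line FIXED POINTWISE by the local tower group.**  As
`WeierstrassCurve.localTowerTorsionFiniteAt_of_noStableDivisibleLine` (seat `bsd-potss-kmc` g16, whose proof this is — adapted
verbatim, one hypothesis threaded through): for an elliptic `E/K`, a prime `p`, a `ℤ_p`-extension `κ` and a finite place
`𝔭`, IF (i′) every `D_𝔭`-stable `p`-divisible subgroup `N ≤ E(K̄)[p^∞]` with `#N[p] ≤ p` that is moreover FIXED POINTWISE by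
`D_𝔭 ⊓ ker κ` is zero, and (ii) some `p`-torsion point is moved by `D_𝔭 ⊓ ker κ`, THEN the `p`-primary torsion fixed by
`D_𝔭 ⊓ ker κ` is finite.  (At a potentially ORDINARY prime there ARE stable divisible lines — the kernel of reduction — so
kmc's (i) fails; (i′) is what the ordinary argument of §4 supplies.)  The fixed module `B` is `D_𝔭`-stable; were it infinite,
its stable image `p^{j₀}B ⊆ B` would be a non-zero `D_𝔭`-stable divisible subgroup fixed pointwise by the tower group, proper
by (ii), hence with `≤ p` points of order `p`, against (i′). [cite: GreenbergLNM1716, §3 Lemma 3.3 (p. 87)]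
[cite: JetchevSkinnerWan2017, Prop. 3.3.4 Case 3(b) (arXiv:1512.06894 p. 13)] -/
theorem _root_.WeierstrassCurve.localTowerTorsionFiniteAt_of_noFixedStableDivisibleLine
    {K : Type} [Field K] [NumberField K] (E : WeierstrassCurve K) [E.IsElliptic] (p : ℕ)
    [hp : Fact p.Prime] (κ : ZpExtension K p) (𝔭 : HeightOneSpectrum (𝓞 K))
    (hline : ∀ N : AddSubgroup (E.geomPrimaryTorsion p),
      (∀ d ∈ decomp 𝔭, ∀ c ∈ N, d • c ∈ N) → (∀ c ∈ N, ∃ c' ∈ N, p • c' = c) →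
      Set.ncard {c : E.geomPrimaryTorsion p | c ∈ N ∧ p • c = 0} ≤ p →
      (∀ c ∈ N, ∀ g ∈ decomp 𝔭 ⊓ κ.kerSubgroup, g • c = c) → N = ⊥)
    (hmove : ∃ m : E.geomPrimaryTorsion p, p • m = 0 ∧
      ∃ g ∈ decomp 𝔭 ⊓ κ.kerSubgroup, g • m ≠ m) :
    LocalTowerTorsionFiniteAt E p κ 𝔭 := by
  have hpr : p.Prime := hp.out
  unfold LocalTowerTorsionFiniteAt
  set M : AddSubgroup E.geomPoints := E.geomPrimaryTorsion p with hM
  set H : Subgroup (absoluteGaloisGroup K) := decomp 𝔭 ⊓ κ.kerSubgroup with hH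
  set B : AddSubgroup M := FixedPoints.addSubgroup H M with hB
  by_contra hinf
  have hinfB : ¬ Finite B := fun h ↦ by
    haveI := h
    exact hinf (Set.toFinite _)
  -- `H` is normalised by `D_𝔭`: `d⁻¹ τ d ∈ H` for `d ∈ D_𝔭`, `τ ∈ H`
  have hconj : ∀ d ∈ decomp 𝔭, ∀ τ ∈ H, d⁻¹ * τ * d ∈ H := by
    intro d hd τ hτ
    obtain ⟨hτD, hτk⟩ := Subgroup.mem_inf.mp hτ
    refine Subgroup.mem_inf.mpr ⟨(decomp 𝔭).mul_mem ((decomp 𝔭).mul_mem ((decomp 𝔭).inv_mem hd) hτD) hd, ?_⟩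
    rw [ZpExtension.mem_kerSubgroup] at hτk ⊢
    rw [map_mul, map_mul, map_inv, hτk, mul_one, inv_mul_cancel]
  -- hence the fixed module `B` is `D_𝔭`-stable
  have hBstab : ∀ d ∈ decomp 𝔭, ∀ {m : M}, m ∈ B → d • m ∈ B := by
    intro d hd m hm
    rw [hB, FixedPoints.mem_addSubgroup] at hm ⊢
    rintro ⟨τ, hτ⟩
    have h := hm ⟨d⁻¹ * τ * d, hconj d hd τ hτ⟩
    rw [Subgroup.mk_smul] at h ⊢
    calc τ • d • m = d • ((d⁻¹ * τ * d) • m) := by rw [mul_smul, mul_smul, smul_inv_smul]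
      _ = d • m := by rw [h]
  -- `M` and `B` are `p`-primary, `B[p]` is finite
  have htorM : ∀ x : M, ∃ k : ℕ, p ^ k • x = 0 := fun x ↦ by
    obtain ⟨k, hk⟩ := x.2
    exact ⟨k, Subtype.ext (by rw [AddSubgroupClass.coe_nsmul, hk]; rfl)⟩
  have hprimB : ∀ b : B, ∃ k : ℕ, p ^ k • b = 0 := fun b ↦ by
    obtain ⟨k, hk⟩ := htorM (b : M)
    exact ⟨k, Subtype.ext (by rw [AddSubgroupClass.coe_nsmul, hk]; rfl)⟩
  haveI : Finite (E.geomTorsion ((p : ℕ) : ℤ)) :=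
    E.finite_torsionPoints_holds (AlgebraicClosure K) (by exact_mod_cast hpr.ne_zero)
  haveI : Finite ((B)[(p : ℕ)]) := by
    refine Finite.of_injective (fun x : (B)[(p : ℕ)] ↦
      (⟨(((x : B) : M) : E.geomPoints), ?_⟩ : E.geomTorsion ((p : ℕ) : ℤ))) ?_
    · refine AddSubgroup.torsionBy.nsmul_iff.mpr ?_
      have h := congrArg (fun b : B ↦ ((b : M) : E.geomPoints))
        (AddSubgroup.torsionBy.nsmul_iff.mp x.2)
      simpa only [AddSubmonoidClass.coe_nsmul, ZeroMemClass.coe_zero] using h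
    · intro x y hxy
      have h := congrArg Subtype.val hxy
      dsimp only at h
      exact Subtype.ext (Subtype.ext (Subtype.ext h))
  -- the stable image `D₀ = p^{j₀} B`: infinite and `p`-divisible
  obtain ⟨j₀, hj₀⟩ := PrimaryGroup.exists_powRange_succ_eq p hprimB
  obtain ⟨t, ht⟩ := PrimaryGroup.exists_card_quotient_powRange_le p hprimB
  set D₀ : AddSubgroup B := (nsmulAddMonoidHom (p ^ j₀) : B →+ B).range with hD₀
  have hD₀inf : ¬ Finite D₀ := by
    intro hfin
    apply hinfB
    haveI := (ht j₀).1
    refine Nat.finite_of_card_ne_zero ?_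
    rw [← AddSubgroup.card_mul_index D₀, AddSubgroup.index_eq_card]
    exact mul_ne_zero Nat.card_pos.ne' Nat.card_pos.ne'
  have hdiv₀ : ∀ x ∈ D₀, ∃ y ∈ D₀, p • y = x := by
    rintro x hx
    have hx' : x ∈ (nsmulAddMonoidHom (p ^ (j₀ + 1)) : B →+ B).range := by rw [hj₀]; exact hx
    obtain ⟨c, rfl⟩ := hx'
    refine ⟨p ^ j₀ • c, ⟨c, rfl⟩, ?_⟩
    change p • p ^ j₀ • c = p ^ (j₀ + 1) • c
    rw [pow_succ', mul_smul]
  -- push the stable image down to `M = E[p^∞]`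
  set N : AddSubgroup M := D₀.map B.subtype with hN
  have hNdiv : ∀ c ∈ N, ∃ c' ∈ N, p • c' = c := by
    rintro _ ⟨b, hb, rfl⟩
    obtain ⟨c, hc, hcb⟩ := hdiv₀ b hb
    exact ⟨B.subtype c, ⟨c, hc, rfl⟩, by rw [← map_nsmul, hcb]⟩
  have hNstab : ∀ d ∈ decomp 𝔭, ∀ c ∈ N, d • c ∈ N := by
    rintro d hd _ ⟨b, ⟨c, rfl⟩, rfl⟩
    set c' : B := ⟨d • (c : M), hBstab d hd c.2⟩ with hc'
    refine ⟨p ^ j₀ • c', ⟨c', rfl⟩, ?_⟩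
    rw [map_nsmul, nsmulAddMonoidHom_apply, map_nsmul, smul_comm d (p ^ j₀) (B.subtype c)]
    rfl
  have hNfix : ∀ c ∈ N, ∀ g ∈ H, g • c = c := by
    rintro _ ⟨b, -, rfl⟩ g hg
    have hb : (b : M) ∈ FixedPoints.addSubgroup H M := b.2
    rw [FixedPoints.mem_addSubgroup] at hb
    have h := hb ⟨g, hg⟩
    rw [Subgroup.mk_smul] at h
    exact h
  -- `N ≠ ⊤` by (ii)
  have hNtop : N ≠ ⊤ := by
    intro htop
    obtain ⟨m, -, g, hg, hne⟩ := hmove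
    exact hne (hNfix m (by rw [htop]; exact AddSubgroup.mem_top m) g hg)
  -- so `#N[p] ≤ p`, and (i) kills `N`
  have hN1 : Set.ncard {c : E.geomPrimaryTorsion p | c ∈ N ∧ p • c = 0} ≤ p :=
    ncard_pTorsion_le_of_divisible_of_ne_top N htorM (ncard_geomPrimaryTorsion_pTorsion_eq_sq E)
      hNdiv hNtop
  have hNbot : N = ⊥ := hline N hNstab hNdiv hN1 hNfix
  apply hD₀inf
  haveI : Subsingleton D₀ := by
    refine ⟨fun x y ↦ Subtype.ext (B.subtype_injective ?_)⟩
    have hx : B.subtype (x : B) ∈ N := ⟨x, x.2, rfl⟩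
    have hy : B.subtype (y : B) ∈ N := ⟨y, y.2, rfl⟩
    rw [hNbot, AddSubgroup.mem_bot] at hx hy
    rw [hx, hy]
  infer_instance

end Summit.BirchSwinnertonDyer.BirchSwinnertonDyer.Theorems.TowerTorsionFiniteOrdinary

end
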